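import Summits.ResolutionOfSingularities.ResolutionOfSingularities.Theorems.MarkedTransferCampaignW46PlaneInvariant
import Summits.ResolutionOfSingularities.ResolutionOfSingularities.Theorems.MarkedTransferCampaignW46ProcrastinationPlane
import Literature.AlgebraicGeometry.Hironaka2017.ARSchemeSingGluing
import HarnessLib

/-!
# [OURS · L1 W4.6 rung (i-d)′] NON-PROCRASTINATION IS NECESSARY FOR ANY INVARIANT: résumé-free infinite permissible
# sequences on the plane, and «no state measure drops along all permissible steps on surfaces»
# (cell res-hironaka, LADDER-RESOLUTION rung L, D-0089; campaign s46, prover res-L1-s46-pv-1; host route MarkedTransfer,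
# `--supports stmt-ResolutionOfSingularities-16155`)

HONEST FRAMING. Nothing here is a statement of H. Hironaka's manuscript (2017-03-23, [Hironaka2017]) and nothing here is a
claim about it. This file is the résumé-free companion of the negative half of rung (i) (p472353/p473754/p475556, which
construct infinite runs of the TYPED procedure modulo résumé coverage): it constructs, with NO hypothesis beyond a perfect
ground field, an infinite §2.1-permissible sequence of standard ideal exponents on surfaces (`PermissibleRun`, p469934) from
any standard state with infinite singular locus — e.g. from the plane `(𝔸²_K, (𝓘_{x₁=0}, 1))` — by blowing up closed
singular points forever. CONSEQUENCE for rung (i-d) (OUR invariant `ι`, `…PlaneInvariant`, p529691): the hypothesis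
«the centre does not procrastinate» of `PlaneInvariantDecreases` cannot be dropped for ANY state function whatsoever —
no map from states to a well-founded order decreases at every §2.1-permissible step between surface states
(`not_exists_stateMeasure_lt`). AI-written; weaker than expert review. No `sorry`; axioms standard.

## Contents

* `exists_permissibleStep_of_sing_infinite` — THE ENGINE, résumé-free: over a perfect field, a standard `E` with infinite
  `Sing(E)` admits a §2.1-permissible centre (a closed point of `Sing(E)`) whose blow-up is an ambient datum of no larger
  dimension on which the transform is standard with infinite singular locus.
* `SState`, `SState.seq`, `singInfiniteRun` — the infinite permissible sequence from such a state; `singInfiniteRun_dimLE`.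
* `exists_permissibleRun_dimLE`, `exists_permissibleRun_plane` — existence statements (`dimLE d`, and the plane, `d = 2`).
* **`not_exists_stateMeasure_lt`** — for every preorder `α` with well-founded `<`, there is NO `Φ : (A, E) ↦ α` with
  `Φ(A′, E′) < Φ(A, E)` at every §2.1-permissible step between standard states of dimension `≤ 2` (perfect `K`).
  With rung (i-c) (`PermissibleRun.infinite_setOf_procrastinates`, p528373) the constructed sequence procrastinates
  infinitely often, which is exactly where OUR invariant is allowed to stall.

## References

* companion modules: `…LiteralCentreProcrastination` (p472353: `sing_transform_infinite`, geometry of ambient data),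
  `…ProcrastinationPlane` (p473754: the plane datum), `…PlaneInvariant` (p529691), `…PlaneRungI` (p528373).
* H. Hironaka, ms. 2017-03-23, §2.1 p.4 l.34–39, Def. 2.1 p.5 — scope only, under adjudication, not cited as fact.
  [Hironaka2017]
-/

noncomputable section

set_option linter.dupNamespace false -- mandated namespace of this single-conjunct summit

open CategoryTheory AlgebraicGeometry TopologicalSpace

namespace Summit.ResolutionOfSingularities.ResolutionOfSingularities.Theorems

namespace CampaignW46

open Literature.AlgebraicGeometry.Resolution
open Literature.AlgebraicGeometry.Hironaka2017.S02Preliminaries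
open Literature.AlgebraicGeometry.Hironaka2017.Datum
open Scheme.IdealSheafData

universe u

variable {p : ℕ} [Fact p.Prime] {K : Type u} [Field K] [CharP K p]

/-! ## The engine: one permissible point blow-up keeping the singular locus infinite -/

section Engine

variable [PerfectField K]

/-- **The engine (résumé-free).** [OURS · L1 W4.6] NOT a statement of the manuscript. Over a perfect field: a standard
ideal exponent `E` with INFINITE singular locus on an ambient datum `A` admits a §2.1-permissible centre — a closed point
`x` of the closed set `Sing(E)` — and the blowing up `π : Z′ → Z` at `x` is an ambient datum `A′` over the same field
(`A′.hom = π ≫ A.hom`), of no larger dimension, on which the transform `E′` is again standard with infinite singular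
locus (`sing_transform_infinite`). [folklore] -/
theorem exists_permissibleStep_of_sing_infinite (A : AmbientDatum p K) (E : IdealExponent A.Z) (hE : E.IsStandard)
    (hinf : E.sing.Infinite) :
    ∃ (A' : AmbientDatum p K) (D : Closeds A.Z) (π : A'.Z ⟶ A.Z),
      E.IsPermissibleCentre A.hom D ∧ A'.hom = π ≫ A.hom ∧ IsBlowup π (vanishingIdeal D) ∧
        (E.transform π D).IsStandard ∧ (E.transform π D).sing.Infinite ∧
          ∀ d : ℕ, topologicalKrullDim A.Z ≤ (d : WithBot ℕ∞) → topologicalKrullDim A'.Z ≤ (d : WithBot ℕ∞) := by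
  classical
  haveI := A.smooth
  haveI := A.irreducible
  haveI := A.quasiCompact
  haveI : IsLocallyNoetherian A.Z := ambient_isLocallyNoetherian A
  haveI : IsIntegral A.Z := ambient_isIntegral A
  haveI : JacobsonSpace A.Z := ambient_jacobsonSpace A
  have hZreg : Scheme.IsRegular A.Z := ambient_isRegular A
  -- a closed point of the closed set `Sing(E)`
  have hScl : IsClosed E.sing := A.isClosed_sing E
  obtain ⟨x, hxS, hxcl⟩ := nonempty_inter_closedPoints hinf.nonempty hScl.isLocallyClosed
  rw [mem_closedPoints_iff] at hxcl
  let D : Closeds A.Z := ⟨{x}, hxcl⟩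
  -- `{x}` is a §2.1-permissible centre
  have hreg : Scheme.IsRegular (vanishingIdeal D).subscheme := isRegular_subscheme_vanishingIdeal_singleton hxcl
  have hcentre : E.IsPermissibleCentre A.hom D :=
    { irreducible := isIrreducible_singleton
      smooth := smooth_of_isRegular_of_perfectField _ hreg
      subset_sing := Set.singleton_subset_iff.2 hxS }
  -- the blow-up of `Z` at `x`
  obtain ⟨Z', π, hπ⟩ := exists_isBlowup A.Z (vanishingIdeal D)
  obtain ⟨y, hy, hyx⟩ : ∃ y ∈ E.sing, y ≠ x := by
    by_contra! h
    exact hinf ((Set.finite_singleton x).subset fun y hy => h y hy)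
  have hne : ({x} : Set A.Z) ≠ Set.univ := fun h => hyx (by
    have : y ∈ ({x} : Set A.Z) := h ▸ Set.mem_univ y
    exact this)
  have hDtop : (vanishingIdeal D).support ≠ ⊤ := by
    intro h
    apply hne
    have := congrArg (fun S : Closeds A.Z => (S : Set A.Z)) h
    simpa [coe_support_vanishingIdeal, D] using this
  have hDne : vanishingIdeal D ≠ ⊥ := fun h => hDtop (by rw [h, Scheme.IdealSheafData.support_bot])
  haveI : IsIntegral Z' := hπ.isIntegral hDne
  haveI : IsProper π := hπ.isProper
  have hZ'reg : Scheme.IsRegular Z' := hπ.isRegular_of_isRegular_subscheme hZreg hreg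
  haveI : Smooth (π ≫ A.hom) := smooth_of_isRegular_of_perfectField _ hZ'reg
  let A' : AmbientDatum p K :=
    { Z := Z', hom := π ≫ A.hom, irreducible := inferInstance, smooth := inferInstance,
      quasiCompact := inferInstance }
  haveI : IsLocallyNoetherian A'.Z := ambient_isLocallyNoetherian A'
  refine ⟨A', D, π, hcentre, rfl, hπ, ⟨?_, hE.2⟩, ?_, fun d hd => hπ.topologicalKrullDim_le hd⟩
  · -- `J′ ⊇ J𝒪_{Z′} ≠ 0`
    intro hbot
    apply hπ.comap_ne_bot hDtop hE.1
    have hle : E.J.comap π ≤ (E.transform π D).J := comap_le_controlledTransform π (vanishingIdeal D) E.J E.b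
    rw [hbot] at hle
    exact le_bot_iff.1 hle
  · exact sing_transform_infinite hxcl hπ E hinf

end Engine

/-! ## The infinite permissible sequence -/

section Run

variable [PerfectField K] {d : ℕ}

/-- [OURS · L1 W4.6] Bookkeeping: a state of the sequence — ambient datum of dimension `≤ d`, standard ideal exponent with
infinite singular locus. [folklore] -/
structure SState (p : ℕ) [Fact p.Prime] (K : Type u) [Field K] [CharP K p] (d : ℕ) where
  /-- ambient datum -/
  A : AmbientDatum p K
  /-- ideal exponent -/
  E : IdealExponent A.Z
  /-- standard -/
  std : E.IsStandard
  /-- dimension bound -/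
  dim : topologicalKrullDim A.Z ≤ (d : WithBot ℕ∞)
  /-- infinite singular locus -/
  inf : E.sing.Infinite

/-- [OURS · L1 W4.6] Bookkeeping: a permissible step out of a state, with its target state. [folklore] -/
structure SState.Link (S : SState p K d) where
  /-- the next state -/
  S' : SState p K d
  /-- the centre -/
  D : Closeds S.A.Z
  /-- the blow-up -/
  π : S'.A.Z ⟶ S.A.Z
  /-- permissible -/
  perm : S.E.IsPermissibleCentre S.A.hom D
  /-- same base field -/
  hom_eq : S'.A.hom = π ≫ S.A.hom
  /-- blow-up along the centre -/
  blowup : IsBlowup π (vanishingIdeal D)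
  /-- the next ideal exponent is the transform -/
  hE : S'.E = S.E.transform π D

/-- The next state exists (engine). [folklore] -/
theorem SState.nonempty_link (S : SState p K d) : Nonempty S.Link := by
  obtain ⟨A', D, π, hD, hhom, hπ, hst, hinf, hdim⟩ := exists_permissibleStep_of_sing_infinite S.A S.E S.std S.inf
  exact ⟨⟨⟨A', _, hst, hdim d S.dim, hinf⟩, D, π, hD, hhom, hπ, rfl⟩⟩

/-- A chosen next state. [folklore] -/
def SState.next (S : SState p K d) : S.Link :=
  Classical.choice S.nonempty_link

/-- The sequence of states from an initial one. [folklore] -/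
def SState.seq (S₀ : SState p K d) : ℕ → SState p K d
  | 0 => S₀
  | k + 1 => ((SState.seq S₀ k).next).S'

/-- [OURS · L1 W4.6] NOT a statement of the manuscript. **The infinite §2.1-permissible sequence** from a standard state with
infinite singular locus (résumé-free): blow up a closed singular point, forever. [folklore] -/
def singInfiniteRun (S₀ : SState p K d) : PermissibleRun p K where
  A k := (S₀.seq k).A
  E k := (S₀.seq k).E
  D k := (S₀.seq k).next.D
  π k := (S₀.seq k).next.π
  standard k := (S₀.seq k).std
  permissible k := (S₀.seq k).next.perm
  hom_eq k := (S₀.seq k).next.hom_eq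
  blowup k := (S₀.seq k).next.blowup
  E_succ k := (S₀.seq k).next.hE

/-- Every stage of the sequence lies in `dimLE d`. [folklore] -/
theorem singInfiniteRun_dimLE (S₀ : SState p K d) (k : ℕ) :
    Regime.dimLE d ((singInfiniteRun S₀).A k) ((singInfiniteRun S₀).E k) :=
  (S₀.seq k).dim

/-- [OURS · L1 W4.6] NOT a statement of the manuscript. **Infinite §2.1-permissible sequences exist in `dimLE d`** (perfect
`K`) from every standard state of dimension `≤ d` with infinite singular locus — no résumés, no coverage hypothesis.
[folklore] -/
theorem exists_permissibleRun_dimLE (d : ℕ) {A₀ : AmbientDatum p K} {E₀ : IdealExponent A₀.Z}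
    (h₀d : topologicalKrullDim A₀.Z ≤ (d : WithBot ℕ∞)) (h₀s : E₀.IsStandard) (h₀i : E₀.sing.Infinite) :
    ∃ r : PermissibleRun p K, ∀ k, Regime.dimLE d (r.A k) (r.E k) :=
  ⟨singInfiniteRun (⟨A₀, E₀, h₀s, h₀d, h₀i⟩ : SState p K d), singInfiniteRun_dimLE _⟩

/-- [OURS · L1 W4.6] NOT a statement of the manuscript. **An infinite §2.1-permissible sequence on surfaces exists** over
every perfect field of characteristic `p`: start from the plane `𝔸²_K` with `(𝓘_{x₁=0}, 1)` (p473754) and blow up closed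
singular points forever. By rung (i-c) it procrastinates infinitely often. [folklore] -/
theorem exists_permissibleRun_plane :
    ∃ r : PermissibleRun p K, ∀ k, Regime.dimLE 2 (r.A k) (r.E k) :=
  exists_permissibleRun_dimLE 2 (planeAmbientDatum_dimLE_two p K) (planeLineExponent_isStandard p K)
    (planeLineExponent_sing_infinite p K)

end Run

/-! ## No state measure decreases along all permissible steps on surfaces -/

/-- [OURS · L1 W4.6 rung (i-d)′] NOT a statement of the manuscript. **NON-PROCRASTINATION IS NECESSARY FOR ANY
INVARIANT.** Over a perfect field of characteristic `p`, for every preorder `α` whose `<` is well founded there is NO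
function `Φ` of states `(A, E)` with `Φ(A′, E′) < Φ(A, E)` at every §2.1-permissible step (standard `E`, ambient
dimension `≤ 2`, permissible centre, blow-up over the same field, transform of Def. 2.1): the infinite permissible
sequence `exists_permissibleRun_plane` would give an infinite descending chain. So the hypothesis
`¬ CentreProcrastinates E D` of `PlaneInvariantDecreases` (p529691) — or some other restriction of the steps — cannot
be removed, whatever the invariant. [folklore] -/
theorem not_exists_stateMeasure_lt [PerfectField K] {α : Type*} [Preorder α] [WellFoundedLT α] :
    ¬ ∃ Φ : ∀ A : AmbientDatum p K, IdealExponent A.Z → α,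
      ∀ (A A' : AmbientDatum p K) (E : IdealExponent A.Z), E.IsStandard → Regime.dimLE 2 A E →
        ∀ (D : Closeds A.Z), E.IsPermissibleCentre A.hom D →
          ∀ (π : A'.Z ⟶ A.Z), A'.hom = π ≫ A.hom → IsBlowup π (vanishingIdeal D) →
            Φ A' (E.transform π D) < Φ A E := by
  rintro ⟨Φ, hΦ⟩
  obtain ⟨r, hr⟩ := exists_permissibleRun_plane (p := p) (K := K)
  let f : ℕ → α := fun k => Φ (r.A k) (r.E k)
  have hf : ∀ k, f (k + 1) < f k := by
    intro k
    change Φ (r.A (k + 1)) (r.E (k + 1)) < Φ (r.A k) (r.E k)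
    rw [r.E_succ k]
    exact hΦ (r.A k) (r.A (k + 1)) (r.E k) (r.standard k) (hr k) (r.D k) (r.permissible k) (r.π k) (r.hom_eq k)
      (r.blowup k)
  exact (wellFounded_iff_isEmpty_descending_chain.mp (wellFounded_lt (α := α))).false ⟨f, hf⟩

/-! ## Résumé-free non-termination of §2.1-permissible sequences in `dimLE d`, `d ≥ 2` (appended v2) -/

/-- [OURS · L1 W4.6 rung (i), negative half, résumé-free] NOT a statement of the manuscript. Over a perfect field of
characteristic `p`, §2.1-permissible sequences do NOT all terminate in the regime `dimLE d` for any `d ≥ 2`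
(`¬ PermissiblyTerminates (Regime.dimLE d)`): the plane sequence `exists_permissibleRun_plane` lies in it. The
résumé-free counterpart of `not_terminates_dimLE_of_resumesCover` (p472353), with no coverage hypothesis — and the
reason every positive rung of this campaign restricts the STEPS (non-procrastination, ∇-components, isolated `Sing`)
and not only the states. [folklore] -/
theorem not_permissiblyTerminates_dimLE [PerfectField K] {d : ℕ} (hd : 2 ≤ d) :
    ¬ PermissiblyTerminates (Regime.dimLE d (p := p) (K := K)) := by
  intro h
  obtain ⟨r, hr⟩ := exists_permissibleRun_plane (p := p) (K := K)
  refine h r fun k => (hr k).trans ?_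
  exact_mod_cast hd

/-- [OURS · L1 W4.6 rung (i), negative half, résumé-free] NOT a statement of the manuscript. In particular
`¬ PermissiblyTerminates Regime.top` over every perfect field of characteristic `p`. [folklore] -/
theorem not_permissiblyTerminates_top [PerfectField K] : ¬ PermissiblyTerminates (Regime.top (p := p) (K := K)) := by
  intro h
  obtain ⟨r, -⟩ := exists_permissibleRun_plane (p := p) (K := K)
  exact h r fun _ => trivial

end CampaignW46

end Summit.ResolutionOfSingularities.ResolutionOfSingularities.Theorems

end
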